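import Mathlib
import Literature.NumberTheory.Automorphic.HilbertModularFormQExpansion

/-!
# Crux `HilbertIntegralOverconvergentIsCongruence` (stmt-Langlands-8485), line `Sketch-ideate-r1-k1`, RESHAPE 16 (§ T):
# registered stub T6 `stub_groupedRelation`

Grouping the engine relation by powers of the unknown; non-triviality of some coefficient form.
-/

set_option linter.dupNamespace false

noncomputable section

namespace Summit.Langlands.Langlands.Theorems.HilbertIntegralOverconvergentIsCongruence

open MeasureTheory Complex NumberField
open Literature.NumberTheory.Automorphic Literature.NumberTheory.Automorphic.HilbertModular
open scoped MatrixGroups NumberField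

/-- Grouping the engine relation by powers of the unknown `γ`: with
`Fm j := ∑_s P_{j,s} · mono_s · G ^ j` (the coefficient of `γ ^ j`, `j < D`), the Sigma-indexed sum
`∑_{(j,s)} P_{(j,s)} · mono_s · G ^ j · γ ^ j` equals `∑_{j<D} Fm j · γ ^ j`; and if `P ≠ 0`, `G ≢ 0` on `ℍ`,
holomorphic functions on `ℍ` have no zero divisors and the monomials of each degree in the `gf l` are
linearly independent on `ℍ`, then some `Fm j` (`j < D`) is not identically zero on `ℍ`. [folklore] -/
theorem stub_groupedRelation (F : Type) [Field F] [NumberField F] (d D : ℕ)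
    (gf : Fin (d + 1) → Point F → ℂ) (G γ : Point F → ℂ)
    (hgf : ∀ l, IsHolomorphicOn F (gf l)) (hG : IsHolomorphicOn F G) (hG0 : ∃ z ∈ halfSpace F, G z ≠ 0)
    (hnzd : ∀ f g : Point F → ℂ, IsHolomorphicOn F f → IsHolomorphicOn F g →
      (∀ z ∈ halfSpace F, f z * g z = 0) → (∃ z ∈ halfSpace F, f z ≠ 0) → ∀ z ∈ halfSpace F, g z = 0)
    (hindep : ∀ (m : ℕ) (κ : Sym (Fin (d + 1)) m → ℂ),
      (∀ z ∈ halfSpace F, ∑ s, κ s * ((s : Multiset (Fin (d + 1))).map (fun l ↦ gf l z)).prod = 0) → ∀ s, κ s = 0)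
    (P : ((j : Fin D) × Sym (Fin (d + 1)) (D - j)) → ℂ) (hP : P ≠ 0)
    (Fm : ℕ → Point F → ℂ)
    (hFm : ∀ j z, Fm j z = if h : j < D then
        ∑ s : Sym (Fin (d + 1)) (D - j),
          P ⟨⟨j, h⟩, s⟩ * (((s : Multiset (Fin (d + 1))).map (fun l ↦ gf l z)).prod * G z ^ j)
      else 0) :
    (∀ z, ∑ j ∈ Finset.range D, Fm j z * γ z ^ j =
        ∑ u : (j : Fin D) × Sym (Fin (d + 1)) (D - j),
          P u * (((u.2 : Multiset (Fin (d + 1))).map (fun l ↦ gf l z)).prod * G z ^ (u.1 : ℕ) * γ z ^ (u.1 : ℕ))) ∧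
    ∃ j < D, ∃ z ∈ halfSpace F, Fm j z ≠ 0 := by
  refine ⟨fun z ↦ ?_, ?_⟩
  · rw [← Fin.sum_univ_eq_sum_range (fun j ↦ Fm j z * γ z ^ j) D, Fintype.sum_sigma]
    refine Finset.sum_congr rfl fun j _ ↦ ?_
    rw [hFm, dif_pos j.isLt, Finset.sum_mul]
    exact Finset.sum_congr rfl fun s _ ↦ by ring
  · obtain ⟨⟨j₀, s₀⟩, hu₀⟩ := Function.ne_iff.mp hP
    simp only [Pi.zero_apply] at hu₀
    by_contra hcon
    push Not at hcon
    apply hu₀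
    -- each monomial in the `gf l` is holomorphic on `ℍ`
    have hmono : ∀ s : Sym (Fin (d + 1)) (D - (j₀ : ℕ)),
        DifferentiableOn ℂ (fun z ↦ ((s : Multiset (Fin (d + 1))).map (fun l ↦ gf l z)).prod)
          (halfSpace F) := by
      intro s z hz
      classical
      exact (HasFDerivWithinAt.multiset_prod fun i _ ↦
        ((hgf i : DifferentiableOn ℂ (gf i) (halfSpace F)) z hz).hasFDerivWithinAt).differentiableWithinAt
    obtain ⟨z₀, hz₀, hGz₀⟩ := hG0
    -- `G ^ j₀ · h = Fm j₀ = 0` on `ℍ` with `G ^ j₀ ≢ 0`, hence `h ≡ 0` on `ℍ`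
    have hz : ∀ z ∈ halfSpace F, (∑ s : Sym (Fin (d + 1)) (D - (j₀ : ℕ)),
        P ⟨j₀, s⟩ * ((s : Multiset (Fin (d + 1))).map (fun l ↦ gf l z)).prod) = 0 := by
      refine hnzd (fun z ↦ G z ^ (j₀ : ℕ)) (fun z ↦ ∑ s : Sym (Fin (d + 1)) (D - (j₀ : ℕ)),
        P ⟨j₀, s⟩ * ((s : Multiset (Fin (d + 1))).map (fun l ↦ gf l z)).prod)
        (DifferentiableOn.fun_pow hG _) ?_ ?_ ⟨z₀, hz₀, pow_ne_zero _ hGz₀⟩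
      · exact DifferentiableOn.fun_sum fun s _ ↦ (hmono s).const_mul _
      · intro z hz
        have h0 := hcon j₀ j₀.isLt z hz
        rw [hFm, dif_pos j₀.isLt] at h0
        refine Eq.trans ?_ h0
        rw [Finset.mul_sum]
        exact Finset.sum_congr rfl fun s _ ↦ by ring
    exact hindep (D - (j₀ : ℕ)) (fun s ↦ P ⟨j₀, s⟩) hz s₀

end Summit.Langlands.Langlands.Theorems.HilbertIntegralOverconvergentIsCongruence

end
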